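import Literature.NumberTheory.EllipticCurves.InertiaInvariantsKodairaNeronMultiplicativeProofs
import Literature.NumberTheory.EllipticCurves.BSDSelmerPConverseSerreProofs
import Literature.NumberTheory.EllipticCurves.KodairaNeronUnramifiedInertiaProofs
import Literature.NumberTheory.GaloisRepresentations.InertiaRootsOfUnity
import Literature.NumberTheory.GaloisRepresentations.SL2TransvectionLifting
import HarnessLib

/-!
# At a multiplicative place `v ∤ p` the inertia group acts on `E[p^n]` through `(1 *; 0 1)`

`Proofs` file (theorems only, no definitions, no named facts) in topic
`NumberTheory/EllipticCurves`, sibling of `MultiplicativeRamifiedTorsionProofs`.  By the theory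
of the Tate curve the inertia group at a place `v ∤ p` of multiplicative reduction acts on
`E[p^n] ≅ ⟨ζ_{p^n}, q^{1/p^n}⟩` through matrices `(1 *; 0 1)` (Silverman, *ATAEC*, V.4–V.5 and
Exercise 5.13(b), PDF p. 416 of the held copy, attributed there to Serre, *Abelian `ℓ`-adic
representations* (1968), Ch. IV, A.1.2).  This file proves that shape **without the Tate curve**,
in the form consumed by
`Literature.NumberTheory.EllipticCurves.hasSurjectiveModNGaloisRep_pow_of_unipotent`
(`BSDSelmerPConverseUnipotentProofs`):

* `WeierstrassCurve.smul_smul_sub_eq_of_mem_inertia_of_hasMultiplicativeReductionAt` — for an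
  elliptic curve `E/K` over a number field, a place `v` of multiplicative reduction, a prime `p`
  with `v ∤ p`, `n ≥ 1`, and `τ` in the inertia group `I_𝔐 ≤ Γ_{K_v}`: **`τ` acts unipotently on
  `E(K̄_v)[p^n]`**, `(τ - 1)² = 0`, i.e. `τ (τ P - P) = τ P - P` whenever `p^n P = O`;
* `WeierstrassCurve.exists_unipotent_of_hasMultiplicativeReductionAt` — the global form: if
  moreover some `τ ∈ I_𝔐` moves some `p`-torsion point of `E(K̄_v)` (the conclusion of
  `IsDedekindDomain.HeightOneSpectrum.exists_inertia_map_ne_of_multiplicative`,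
  `MultiplicativeRamifiedTorsionProofs`, when `p ∤ v(Δ_min)`), then some `σ ∈ Γ_K` (namely
  `σ = τ|_{K̄}`) acts on `E[p^n] = E(K̄)[p^n]` with `(σ - 1)² = 0` and non-trivially on `E[p]`.

## Proof

Let `X` be the minimal model at `v`, `W₀` its `𝒪_w`-model over the valuation ring of `K̄_v`
(henselian, algebraically closed residue field `k`), whose reduction is a node, and
`r : E₀(K̄_v) → k^×` the reduction onto the node (`exists_addMonoidHom_units_of_node_of_isAlgClosed`,
kernel `E₁`).  (i) *A fixed point of order `p^n`.*  A preimage of a primitive `p^n`-th root of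
unity `b ∈ k^×`, corrected by a `p^n`-division point of its `p^n`-multiple in `E₁`
(`exists_zsmul_eq_of_one_lt_val`), is a point `P₁ ∈ E₀` with `p^n P₁ = O`, `r(P₁) = b` — so
`p^{n-1} P₁ ≠ O` — and `τ P₁ = P₁` for every `τ ∈ I_𝔐`, because inertia does not move
reductions (`reducePoint_congrEquiv_map_eq`) and reduction is injective on the prime-to-`v`
torsion of `E₀` (`eq_of_reducePoint_eq_of_zsmul_eq_zero`) — verbatim from
`InertiaInvariantsKodairaNeronMultiplicativeProofs`.  (ii) *Determinant one.*  In a frame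
`E(K̄_v)[p^n] ≅ (ℤ/p^n)²` (`nonempty_addEquiv_geomTorsion`, `exists_rep_of_addEquiv`) the matrix
`M` of `τ` has `det M = χ_{p^n}(τ)` (Weil pairing, `det_eq_modNCyclotomicCharacter`) `= 1`, as
`τ` fixes the `p^n`-th roots of unity (`mem_absInertia_iff_smul_rootsOfUnity`,
`inertia_eq_absInertia`: they have order prime to the residue characteristic).  (iii) *Linear
algebra.*  `M c = c` for the coordinate vector `c` of `P₁`, which has a unit entry (else
`p^{n-1} c = 0`), and `det M = 1`; hence `(M - 1)² = 0`
(`mul_self_sub_one_eq_zero_of_mulVec_eq_of_det_eq_one`: with `c = (x, y)`, `x` a unit,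
`M - 1 = b (-t, 1; -t², t)`, `t = y/x`).  (iv) Transport along the `Γ_{K_v}`-equivariant
isomorphisms `E(K̄_v) ≃ X(K̄_v)` (`exists_addEquiv_localPoints_of_smul_eq`) and, for the global
form, along `E(K̄) ↪ E(K̄_v)` (`pointsMap_smul`, and `exists_pointsMapOfEmb_eq_of_nsmul_eq_zero`:
torsion points of `E(K̄_v)` come from `E(K̄)`).

## References

* [SilvermanATAEC1994] J. H. Silverman, *Advanced Topics in the Arithmetic of Elliptic Curves*,
  GTM 151 (1994): V.4–V.5 (Tate curve); Cor. IV.9.2(d).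
* [SilvermanAEC2009] J. H. Silverman, *The Arithmetic of Elliptic Curves*, 2nd ed. (2009):
  VII.2.1–VII.2.2, VII.3.1, III.8 (Weil pairing), VIII.§1.
* [SerreAbelianLadic1968] J.-P. Serre, *Abelian `ℓ`-adic representations and elliptic curves*
  (1968), Ch. IV, A.1.2 (as quoted in *ATAEC*, notes to Ex. 5.13, PDF p. 441).
* [SerreInventiones1972] J.-P. Serre, *Propriétés galoisiennes des points d'ordre fini des courbes
  elliptiques*, Invent. Math. 15 (1972), §1.2 (`I = Gal(K_s/K_nr)`; tree `InertiaRootsOfUnity`).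
* [SerreLocalFields1979] J.-P. Serre, *Local Fields*, Ch. IV §4, Cor. 2 to Prop. 16.

## Design

No definitions; `noncomputable section`; `open scoped Classical NNReal`; one universe `u`.
`set_option maxHeartbeats` raised for the main proof (long, many coercions), as in the template
`InertiaInvariantsKodairaNeronMultiplicativeProofs`, whose setting and steps are followed verbatim.
-/

noncomputable section

open scoped Classical NNReal
open NumberField IsDedekindDomain

universe u

/-! ## Linear algebra: a matrix of determinant one fixing a unimodular vector is unipotent -/

namespace Literature.NumberTheory.EllipticCurves

open Matrix

/-- **A `2 × 2` matrix of determinant `1` fixing a vector with a unit entry is unipotent**: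
if `M c = c` with `c = (x, y)`, `x` (or `y`) a unit, and `det M = 1`, then `(M - 1)² = 0`
(with `s x = 1`, `t = s y`: `M = (1 - bt, b; -bt², 1 + bt)`). [folklore] -/
theorem mul_self_sub_one_eq_zero_of_mulVec_eq_of_det_eq_one {R : Type*} [CommRing R]
    (M : Matrix (Fin 2) (Fin 2) R) (c : Fin 2 → R) (hc : IsUnit (c 0) ∨ IsUnit (c 1))
    (hMc : M *ᵥ c = c) (hdet : M.det = 1) : (M - 1) * (M - 1) = 0 := by
  have h1 : M 0 0 * c 0 + M 0 1 * c 1 = c 0 := by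
    have := congrFun hMc 0
    simpa [Matrix.mulVec, dotProduct, Fin.sum_univ_two] using this
  have h2 : M 1 0 * c 0 + M 1 1 * c 1 = c 1 := by
    have := congrFun hMc 1
    simpa [Matrix.mulVec, dotProduct, Fin.sum_univ_two] using this
  rw [Matrix.det_fin_two] at hdet
  rcases hc with hx | hy
  · obtain ⟨s, hs⟩ := hx.exists_left_inv
    have ha : M 0 0 = 1 - s * M 0 1 * c 1 := by linear_combination s * h1 - (M 0 0 - 1) * hs
    have hc' : M 1 0 = s * (1 - M 1 1) * c 1 := by linear_combination s * h2 - M 1 0 * hs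
    have hd : M 1 1 = 1 + s * M 0 1 * c 1 := by
      linear_combination hdet - M 1 1 * ha + M 0 1 * hc' + (s * M 0 1 * c 1) * hc' * 0
    have hM : M - 1 = !![-(s * M 0 1 * c 1), M 0 1; -(s ^ 2 * M 0 1 * c 1 ^ 2), s * M 0 1 * c 1] := by
      ext i j
      fin_cases i <;> fin_cases j
      · simp; linear_combination ha
      · simp
      · simp; linear_combination hc' - (s * c 1) * hd
      · simp; linear_combination hd
    rw [hM]
    ext i j
    fin_cases i <;> fin_cases j <;> simp [Matrix.mul_apply, Fin.sum_univ_two] <;> ring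
  · obtain ⟨s, hs⟩ := hy.exists_left_inv
    have hd : M 1 1 = 1 - s * M 1 0 * c 0 := by linear_combination s * h2 - (M 1 1 - 1) * hs
    have hb : M 0 1 = s * (1 - M 0 0) * c 0 := by linear_combination s * h1 - M 0 1 * hs
    have ha : M 0 0 = 1 + s * M 1 0 * c 0 := by
      linear_combination hdet - M 0 0 * hd + M 1 0 * hb
    have hM : M - 1 = !![s * M 1 0 * c 0, -(s ^ 2 * M 1 0 * c 0 ^ 2); M 1 0, -(s * M 1 0 * c 0)] := by
      ext i j
      fin_cases i <;> fin_cases j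
      · simp; linear_combination ha
      · simp; linear_combination hb - (s * c 0) * ha
      · simp
      · simp; linear_combination hd
    rw [hM]
    ext i j
    fin_cases i <;> fin_cases j <;> simp [Matrix.mul_apply, Fin.sum_univ_two] <;> ring

end Literature.NumberTheory.EllipticCurves

namespace WeierstrassCurve

open Literature.NumberTheory.EllipticCurves Literature.NumberTheory.GaloisRepresentations Field
  IsDedekindDomain.HeightOneSpectrum Matrix

variable {K : Type u} [Field K] [NumberField K] {v : HeightOneSpectrum (𝓞 K)}
  (W : WeierstrassCurve K)

set_option maxHeartbeats 4000000 in
/-- **At a multiplicative place `v ∤ p` the inertia group acts unipotently on `E(K̄_v)[p^n]`.**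
Let `E/K` be an elliptic curve over a number field, `v` a finite place of multiplicative
reduction, `p` a prime with `v ∤ p`, `n ≥ 1`, `𝔐` the prime of `\\bar 𝓞_v` above `𝓂_v` and
`τ ∈ I_𝔐 ≤ Γ_{K_v}`.  Then for every `P ∈ E(K̄_v)` with `p^n P = O`,
`τ (τ P - P) = τ P - P` (i.e. `(τ - 1)² = 0` on `E(K̄_v)[p^n]`; Tate curve: the inertia group acts
through `(1 *; 0 1)`, Silverman, *ATAEC*, V.4–V.5; proof without the Tate curve in the module
docstring: a fixed point of order `p^n` in `E₀` from Hensel, `det = χ_{p^n} = 1` on inertia, and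
linear algebra). [cite: SilvermanATAEC1994, V.4–V.5 (Tate curve), Exercise 5.13(b) (PDF p. 416), Cor. IV.9.2(d)]
[cite: SilvermanAEC2009, VII.2.1, VII.2.2, VII.3.1, III.8] [cite: SerreAbelianLadic1968, Ch. IV, A.1.2] -/
theorem smul_smul_sub_eq_of_mem_inertia_of_hasMultiplicativeReductionAt [W.IsElliptic]
    (hmult : W.HasMultiplicativeReductionAt v) {p : ℕ} (hp : p.Prime) (hpv : (p : 𝓞 K) ∉ v.asIdeal)
    {n : ℕ} (hn : 1 ≤ n)
    {w : Valuation (AlgebraicClosure (v.adicCompletion K)) ℝ≥0}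
    (hw : ∀ x, (w x : ℝ) =
      spectralNorm (v.adicCompletion K) (AlgebraicClosure (v.adicCompletion K)) x)
    {𝔐 : Ideal v.localAbsIntegers} (h𝔐 : 𝔐 ∈ v.localPrimesAbove)
    {τ : absoluteGaloisGroup (v.adicCompletion K)}
    (hτ : τ ∈ 𝔐.inertia (absoluteGaloisGroup (v.adicCompletion K)))
    (P : localPoints W (v.adicCompletion K)) (hP : p ^ n • P = 0) :
    τ • (τ • P - P) = τ • P - P := by
  have hv0 : w.Integers w.integer := Valuation.integer.integers w
  haveI := henselianRing_integer w
  haveI := isAlgClosed_residueField_integer w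
  haveI : Fact p.Prime := ⟨hp⟩
  -- models
  set X := W.localMinimalModel v with hXdef
  haveI : X.IsElliptic := W.isElliptic_localMinimalModel v
  have hint : (X.baseChange (AlgebraicClosure (v.adicCompletion K))).IsIntegral w.integer := by
    have := isIntegral_spectralValuation_baseChange hw
      (X.integralModel (v.adicCompletionIntegers K))
    rwa [show (X.integralModel (v.adicCompletionIntegers K)).map
        (algebraMap (v.adicCompletionIntegers K) (v.adicCompletion K)) = X from
      baseChange_integralModel_eq (v.adicCompletionIntegers K) X] at this
  haveI := hint
  obtain ⟨W₀, hW₀⟩ := hint.integral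
  -- the reduction of `W₀` is a node
  have hΔeq : algebraMap w.integer (AlgebraicClosure (v.adicCompletion K)) W₀.Δ =
      algebraMap (v.adicCompletion K) (AlgebraicClosure (v.adicCompletion K))
        (algebraMap (v.adicCompletionIntegers K) (v.adicCompletion K)
          (X.integralModel (v.adicCompletionIntegers K)).Δ) := by
    rw [integralModel_Δ_eq, ← map_Δ, ← map_Δ]
    change (W₀.baseChange (AlgebraicClosure (v.adicCompletion K))).Δ =
      (X.baseChange (AlgebraicClosure (v.adicCompletion K))).Δ
    rw [hW₀]
  have hc₄eq : algebraMap w.integer (AlgebraicClosure (v.adicCompletion K)) W₀.c₄ =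
      algebraMap (v.adicCompletion K) (AlgebraicClosure (v.adicCompletion K))
        (algebraMap (v.adicCompletionIntegers K) (v.adicCompletion K)
          (X.integralModel (v.adicCompletionIntegers K)).c₄) := by
    rw [integralModel_c₄_eq, ← map_c₄, ← map_c₄]
    change (W₀.baseChange (AlgebraicClosure (v.adicCompletion K))).c₄ =
      (X.baseChange (AlgebraicClosure (v.adicCompletion K))).c₄
    rw [hW₀]
  have hΔ : IsLocalRing.residue w.integer W₀.Δ = 0 := by
    have hlt := (show X.HasMultiplicativeReduction (v.adicCompletionIntegers K) from hmult).badReduction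
    rw [← integralModel_Δ_eq (v.adicCompletionIntegers K) X] at hlt
    have hmem := (IsDedekindDomain.HeightOneSpectrum.valuation_lt_one_iff_mem _ _).mp hlt
    rw [← v_algebraMap_lt_one_iff hv0, hΔeq]
    exact spectralValuation_algebraMap_lt_one_of_mem_maximalIdeal hw h𝔐 hmem
  have hc₄ : IsLocalRing.residue w.integer W₀.c₄ ≠ 0 := by
    have heq := (show X.HasMultiplicativeReduction (v.adicCompletionIntegers K) from
      hmult).multiplicativeReduction
    rw [← integralModel_c₄_eq (v.adicCompletionIntegers K) X] at heq
    have hnot : (X.integralModel (v.adicCompletionIntegers K)).c₄ ∉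
        IsLocalRing.maximalIdeal (v.adicCompletionIntegers K) := fun hmem ↦ by
      have := (IsDedekindDomain.HeightOneSpectrum.valuation_lt_one_iff_mem
        (K := v.adicCompletion K)
        (IsDiscreteValuationRing.maximalIdeal (v.adicCompletionIntegers K)) _).mpr hmem
      rw [heq] at this
      exact lt_irrefl _ this
    have hunit : IsUnit (X.integralModel (v.adicCompletionIntegers K)).c₄ := by
      by_contra hu
      exact hnot ((IsLocalRing.mem_maximalIdeal _).mpr hu)
    rw [← v_algebraMap_eq_one_iff hv0, hc₄eq]
    exact spectralValuation_eq_one_of_isUnit hw hunit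
  obtain ⟨rn, hrn_surj, hrn⟩ := W₀.exists_addMonoidHom_units_of_node_of_isAlgClosed hv0 hΔ hc₄
  -- transport `E(K̄_v) ≃ X(K̄_v)`
  obtain ⟨C, hC⟩ := W.exists_variableChange_smul_eq_localMinimalModel v
  obtain ⟨Φ, hΦ⟩ := W.exists_addEquiv_localPoints_of_smul_eq v hC
  -- valuations of `p`
  have hpnv : ((p ^ n : ℕ) : 𝓞 K) ∉ v.asIdeal := v.natCast_pow_not_mem hpv n
  have hpnw : w (((p ^ n : ℕ) : ℤ) : AlgebraicClosure (v.adicCompletion K)) = 1 :=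
    spectralValuation_intCast_eq_one hw (n := ((p ^ n : ℕ) : ℤ)) (by simpa using hpnv)
  have hpk : ((p : ℕ) : IsLocalRing.ResidueField w.integer) ≠ 0 := by
    have hpw : w ((p : ℤ) : AlgebraicClosure (v.adicCompletion K)) = 1 :=
      spectralValuation_intCast_eq_one hw (n := (p : ℤ)) (by simpa using hpv)
    have hpw' : w (algebraMap w.integer (AlgebraicClosure (v.adicCompletion K)) (p : w.integer)) = 1 := by
      rw [map_natCast]; exact_mod_cast hpw
    have h1 : IsLocalRing.residue w.integer (p : w.integer) ≠ 0 :=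
      (v_algebraMap_eq_one_iff hv0 _).mp hpw'
    simpa using h1
  haveI hpnk : NeZero (((p ^ n : ℕ) : ℕ) : IsLocalRing.ResidueField w.integer) :=
    ⟨by rw [Nat.cast_pow]; exact pow_ne_zero _ hpk⟩
  haveI : CharZero (v.adicCompletion K) :=
    charZero_of_injective_algebraMap (algebraMap K (v.adicCompletion K)).injective
  have hpF : (p : v.adicCompletion K) ≠ 0 := Nat.cast_ne_zero.mpr hp.ne_zero
  haveI hpnF : NeZero (((p ^ n : ℕ) : ℕ) : v.adicCompletion K) :=
    ⟨by rw [Nat.cast_pow]; exact pow_ne_zero _ hpF⟩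
  /- (i) a point `P₁ ∈ E₀(X)` with `p^n P₁ = O`, `r(P₁) = b` primitive, fixed by inertia -/
  obtain ⟨b₀, hb₀⟩ := HasEnoughRootsOfUnity.exists_primitiveRoot
    (IsLocalRing.ResidueField w.integer) (p ^ n)
  have hb₀unit : IsUnit b₀ := hb₀.isUnit (pow_ne_zero _ hp.ne_zero)
  set b : (IsLocalRing.ResidueField w.integer)ˣ := hb₀unit.unit with hbdef
  have hb : IsPrimitiveRoot b (p ^ n) := by
    refine IsPrimitiveRoot.of_map_of_injective (f := Units.coeHom _) ?_ Units.val_injective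
    rw [Units.coeHom_apply, hbdef, IsUnit.unit_spec]
    exact hb₀
  have hbpow : (p ^ n : ℕ) • (Additive.ofMul b) = 0 := by
    rw [← ofMul_pow, hb.pow_eq_one, ofMul_one]
  obtain ⟨P₀, hP₀⟩ := hrn_surj (Additive.ofMul b)
  set S₀ := (Affine.Point.congrEquiv hW₀).symm
    (P₀ : (W₀.baseChange (AlgebraicClosure (v.adicCompletion K))).toAffine.Point) with hS₀
  have hcS₀ : Affine.Point.congrEquiv hW₀ S₀ = P₀ := by rw [hS₀, AddEquiv.apply_symm_apply]
  have hS₀E₀ : W₀.HasNonsingularReduction (Affine.Point.congrEquiv hW₀ S₀) := by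
    rw [hcS₀]; exact P₀.2
  -- `p^n • S₀ ∈ E₁`
  have hker : W₀.ReducesToZero (Affine.Point.congrEquiv hW₀ ((p ^ n : ℕ) • S₀)) := by
    have h1 : rn ((p ^ n : ℕ) • P₀) = 0 := by rw [map_nsmul, hP₀, hbpow]
    have h2 := (hrn _).mp h1
    rwa [AddSubgroup.coe_nsmul, ← hcS₀, ← map_nsmul] at h2
  -- a torsion point `P₁ ∈ E₀` with `rn`-image `b`
  obtain ⟨P₁, hP₁E₀, hP₁tors, hP₁img⟩ :
      ∃ P₁ : (X.baseChange (AlgebraicClosure (v.adicCompletion K))).toAffine.Point,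
        ∃ hE₀ : W₀.HasNonsingularReduction (Affine.Point.congrEquiv hW₀ P₁),
          (p ^ n : ℕ) • P₁ = 0 ∧ rn ⟨Affine.Point.congrEquiv hW₀ P₁, hE₀⟩ = Additive.ofMul b := by
    rcases hT : ((p ^ n : ℕ) • S₀) with _ | ⟨x, y, hxy⟩
    · refine ⟨S₀, hS₀E₀, by rw [hT, Affine.Point.zero_def], ?_⟩
      rw [← hP₀]; congr 1; exact Subtype.ext hcS₀
    · have hx : 1 < w x := by
        rw [hT, Affine.Point.congrEquiv_some, reducesToZero_some_iff, not_mem_range_iff hv0] at hker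
        exact hker
      obtain ⟨x', y', hxy', hx', hdivpt⟩ := exists_zsmul_eq_of_one_lt_val (w := w)
        (V := X.baseChange (AlgebraicClosure (v.adicCompletion K)))
        (m := ((p ^ n : ℕ) : ℤ)) hpnw hxy hx
      set Q₁ : (X.baseChange (AlgebraicClosure (v.adicCompletion K))).toAffine.Point :=
        .some x' y' hxy' with hQ₁
      have hQ₁E₁ : W₀.ReducesToZero (Affine.Point.congrEquiv hW₀ Q₁) := by
        rw [hQ₁, Affine.Point.congrEquiv_some, reducesToZero_some_iff, not_mem_range_iff hv0]
        exact hx'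
      have hE₀' : W₀.HasNonsingularReduction (Affine.Point.congrEquiv hW₀ (S₀ - Q₁)) := by
        rw [map_sub]
        exact (W₀.nonsingularReductionSubgroup hv0).sub_mem hS₀E₀ hQ₁E₁.hasNonsingularReduction
      have hdivpt' : ((p ^ n : ℕ) : ℤ) • Q₁ = Affine.Point.some x y hxy := by
        rw [hQ₁]; exact hdivpt
      refine ⟨S₀ - Q₁, hE₀', ?_, ?_⟩
      · rw [nsmul_sub, hT, ← natCast_zsmul (Q₁), hdivpt', sub_self]
      · have hsplit : (⟨Affine.Point.congrEquiv hW₀ (S₀ - Q₁), hE₀'⟩ :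
            W₀.nonsingularReductionSubgroup hv0) =
            ⟨Affine.Point.congrEquiv hW₀ S₀, hS₀E₀⟩ -
              ⟨Affine.Point.congrEquiv hW₀ Q₁, hQ₁E₁.hasNonsingularReduction⟩ :=
          Subtype.ext (by
            change Affine.Point.congrEquiv hW₀ (S₀ - Q₁) =
              Affine.Point.congrEquiv hW₀ S₀ - Affine.Point.congrEquiv hW₀ Q₁
            rw [map_sub])
        rw [hsplit, map_sub,
          (hrn ⟨Affine.Point.congrEquiv hW₀ Q₁, hQ₁E₁.hasNonsingularReduction⟩).mpr hQ₁E₁,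
          sub_zero, ← hP₀]
        congr 1; exact Subtype.ext hcS₀
  -- `P₁` is fixed by the inertia group
  have hP₁fix : ∀ σ ∈ 𝔐.inertia (absoluteGaloisGroup (v.adicCompletion K)),
      Affine.Point.map ((absoluteGaloisGroup.toAlgEquiv _ σ :
          AlgebraicClosure (v.adicCompletion K) ≃ₐ[v.adicCompletion K]
            AlgebraicClosure (v.adicCompletion K)) :
          AlgebraicClosure (v.adicCompletion K) →ₐ[v.adicCompletion K]
            AlgebraicClosure (v.adicCompletion K)) P₁ = P₁ := by
    intro σ hσ
    obtain ⟨hσ₁, hσ₂⟩ := isometry_of_mem_inertia hw h𝔐 hσ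
    have hE₀σ := (W₀.hasNonsingularReduction_congrEquiv_map_iff hW₀
      ((absoluteGaloisGroup.toAlgEquiv _ σ :
          AlgebraicClosure (v.adicCompletion K) ≃ₐ[v.adicCompletion K]
            AlgebraicClosure (v.adicCompletion K)) :
          AlgebraicClosure (v.adicCompletion K) →ₐ[v.adicCompletion K]
            AlgebraicClosure (v.adicCompletion K)) hσ₁ hσ₂ P₁).mpr hP₁E₀
    have hred := W₀.reducePoint_congrEquiv_map_eq hW₀
      ((absoluteGaloisGroup.toAlgEquiv _ σ :
          AlgebraicClosure (v.adicCompletion K) ≃ₐ[v.adicCompletion K]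
            AlgebraicClosure (v.adicCompletion K)) :
          AlgebraicClosure (v.adicCompletion K) →ₐ[v.adicCompletion K]
            AlgebraicClosure (v.adicCompletion K)) hσ₁ hσ₂ P₁
    have key := W₀.eq_of_reducePoint_eq_of_zsmul_eq_zero hpnw hE₀σ hP₁E₀
      (by rw [← map_zsmul, ← map_zsmul, natCast_zsmul, hP₁tors, map_zero, map_zero])
      (by rw [← map_zsmul, natCast_zsmul, hP₁tors, map_zero]) hred
    exact (Affine.Point.congrEquiv hW₀).injective key
  -- `P₁` has order exactly `p^n`: `p^(n-1) • P₁ ≠ 0`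
  have hP₁ord : (p ^ (n - 1) : ℕ) • P₁ ≠ 0 := by
    intro h0
    have hmul : rn ((p ^ (n - 1) : ℕ) • ⟨Affine.Point.congrEquiv hW₀ P₁, hP₁E₀⟩) = 0 := by
      have : ((p ^ (n - 1) : ℕ) • (⟨Affine.Point.congrEquiv hW₀ P₁, hP₁E₀⟩ :
          W₀.nonsingularReductionSubgroup hv0)) = 0 :=
        Subtype.ext (by
          change (p ^ (n - 1) : ℕ) • Affine.Point.congrEquiv hW₀ P₁ = 0
          rw [← map_nsmul, h0, map_zero])
      rw [this, map_zero]
    rw [map_nsmul, hP₁img, ← ofMul_pow, ofMul_eq_zero, hb.pow_eq_one_iff_dvd] at hmul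
    have hlt : p ^ (n - 1) < p ^ n := Nat.pow_lt_pow_right hp.one_lt (by omega)
    exact absurd (Nat.le_of_dvd (pow_pos hp.pos _) hmul) (not_le.mpr hlt)
  /- (ii) the frame on `X[p^n]` and the matrix of `τ` -/
  obtain ⟨e⟩ := nonempty_addEquiv_geomTorsion X p n hn hpF
  obtain ⟨ρ, hρ⟩ := exists_rep_of_addEquiv X e
  haveI : NeZero (p ^ n) := ⟨pow_ne_zero _ hp.ne_zero⟩
  set M : Matrix (Fin 2) (Fin 2) (ZMod (p ^ n)) :=
    ((ρ τ : GL (Fin 2) (ZMod (p ^ n))) : Matrix (Fin 2) (Fin 2) (ZMod (p ^ n))) with hM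
  -- `P₁` as an element of `X[p^n]`, fixed by `τ`
  have hP₁mem : (P₁ : geomPoints X) ∈ geomTorsion X ((p ^ n : ℕ) : ℤ) :=
    (Submodule.mem_torsionBy_iff _ _).mpr
      (show ((p ^ n : ℕ) : ℤ) • P₁ = 0 by rw [natCast_zsmul]; exact hP₁tors)
  set P₁' : geomTorsion X ((p ^ n : ℕ) : ℤ) := ⟨(P₁ : geomPoints X), hP₁mem⟩ with hP₁'
  have hτP₁' : τ • P₁' = P₁' := Subtype.ext (hP₁fix τ hτ)
  set c : Fin 2 → ZMod (p ^ n) := e P₁' with hcdef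
  have hMc : M *ᵥ c = c := by rw [hcdef, ← hρ τ P₁', hτP₁']
  -- `c` has a unit entry
  have hc : IsUnit (c 0) ∨ IsUnit (c 1) := by
    by_contra hcon
    rw [not_or] at hcon
    have hn0 : n ≠ 0 := by omega
    have hred0 : ∀ i, ZMod.castHom (dvd_pow_self p hn0) (ZMod p) (c i) = 0 := by
      intro i
      by_contra hne
      have hu := TransvectionLifting.isUnit_of_cast_ne_zero hn0 hne
      fin_cases i
      · exact hcon.1 hu
      · exact hcon.2 hu
    have hpc : (p ^ (n - 1) : ℕ) • c = 0 := by
      funext i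
      obtain ⟨c', hc'⟩ := Serre1968.exists_eq_mul_of_cast_eq_zero hn0 (c i) (hred0 i)
      rw [Pi.smul_apply, Pi.zero_apply, hc', nsmul_eq_mul, ← mul_assoc, Nat.cast_pow,
        ← pow_succ, Nat.sub_add_cancel hn, Serre1968.natCast_pow_eq_zero, zero_mul]
    apply hP₁ord
    have h1 : (p ^ (n - 1) : ℕ) • P₁' = 0 := e.injective (by rw [map_nsmul, map_zero]; exact hpc)
    have h2 := congrArg (fun Q : geomTorsion X ((p ^ n : ℕ) : ℤ) ↦ ((Q : geomPoints X))) h1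
    simp only [AddSubmonoidClass.coe_nsmul, ZeroMemClass.coe_zero] at h2
    exact h2
  -- `det M = χ_{p^n}(τ) = 1`: `τ` fixes the `p^n`-th roots of unity
  have hdet : M.det = 1 := by
    have hχ := det_eq_modNCyclotomicCharacter X (p ^ n)
      (hp.two_le.trans (Nat.le_self_pow (by omega) p)) e τ M (hρ τ)
    rw [hχ]
    -- a primitive `p^n`-th root of unity in `K̄_v`, fixed by `τ`
    haveI : NeZero (((p ^ n : ℕ) : ℕ) : AlgebraicClosure (v.adicCompletion K)) :=
      ⟨by rw [Nat.cast_pow]; exact pow_ne_zero _ (fun h ↦ hpF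
        ((algebraMap (v.adicCompletion K) (AlgebraicClosure (v.adicCompletion K))).injective
          (by rw [map_natCast, map_zero, h])))⟩
    obtain ⟨ζ, hζ⟩ := HasEnoughRootsOfUnity.exists_primitiveRoot
      (AlgebraicClosure (v.adicCompletion K)) (p ^ n)
    have hunit : IsUnit (((p ^ n : ℕ) : ℕ) :
        (ValuativeRel.valuation (v.adicCompletion K)).integer) := by
      by_contra h1
      rw [Valuation.Integer.not_isUnit_iff_valuation_lt_one] at h1
      have h2 : Valued.v ((((p ^ n : ℕ) : ℕ) :
          (ValuativeRel.valuation (v.adicCompletion K)).integer) : v.adicCompletion K) < 1 :=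
        (Valuation.vlt_one_iff (Valued.v : Valuation (v.adicCompletion K)
          (WithZero (Multiplicative ℤ)))).mp
          ((Valuation.vlt_one_iff (ValuativeRel.valuation (v.adicCompletion K))).mpr h1)
      have h3 : ((((p ^ n : ℕ) : ℕ) : (ValuativeRel.valuation (v.adicCompletion K)).integer) :
          v.adicCompletion K) = ((algebraMap (𝓞 K) K ((p ^ n : ℕ) : 𝓞 K) : K) : v.adicCompletion K) := by
        rw [SubringClass.coe_natCast, map_natCast]
        exact (map_natCast (algebraMap K (v.adicCompletion K)) _).symm
      rw [h3, valuedAdicCompletion_eq_valuation', valuation_lt_one_iff_mem] at h2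
      exact hpnv h2
    have hτabs : τ ∈ absInertia (v.adicCompletion K) := by
      rw [← inertia_eq_absInertia hw h𝔐]; exact hτ
    have hfix : τ • ζ = ζ := mem_absInertia_iff_smul_rootsOfUnity.mp hτabs (p ^ n) hunit ζ hζ.pow_eq_one
    have hspec := modNCyclotomicCharacter_spec (v.adicCompletion K) (p ^ n) τ ζ hζ.pow_eq_one
    rw [hfix] at hspec
    have hval : ((modNCyclotomicCharacter (v.adicCompletion K) (p ^ n) τ : (ZMod (p ^ n))ˣ) :
        ZMod (p ^ n)).val = 1 := by
      have h1 : 1 < p ^ n := Nat.one_lt_pow (by omega) hp.one_lt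
      refine (hζ.pow_inj (ZMod.val_lt _) h1 ?_)
      rw [pow_one]; exact hspec.symm
    rw [← ZMod.natCast_zmod_val ((modNCyclotomicCharacter (v.adicCompletion K) (p ^ n) τ :
      (ZMod (p ^ n))ˣ) : ZMod (p ^ n)), hval, Nat.cast_one]
  /- (iii) linear algebra: `(M - 1)² = 0`, hence `τ (τ Q - Q) = τ Q - Q` on `X[p^n]` -/
  have hsq := mul_self_sub_one_eq_zero_of_mulVec_eq_of_det_eq_one M c hc hMc hdet
  have hN : ∀ Q : geomTorsion X ((p ^ n : ℕ) : ℤ), e (τ • Q - Q) = (M - 1) *ᵥ e Q := by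
    intro Q
    rw [map_sub, hρ τ Q, sub_mulVec, one_mulVec]
  have hunip : ∀ Q : geomTorsion X ((p ^ n : ℕ) : ℤ), τ • (τ • Q - Q) = τ • Q - Q := by
    intro Q
    have h0 : e (τ • (τ • Q - Q) - (τ • Q - Q)) = 0 := by
      rw [hN, hN, mulVec_mulVec, hsq, zero_mulVec]
    exact sub_eq_zero.mp (e.injective (h0.trans (map_zero e).symm))
  /- (iv) transport back to `E(K̄_v)` along `Φ` -/
  set Q₀ : geomPoints X := (Φ P : geomPoints X) with hQ₀
  have hQ₀mem : Q₀ ∈ geomTorsion X ((p ^ n : ℕ) : ℤ) :=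
    (Submodule.mem_torsionBy_iff _ _).mpr
      (show ((p ^ n : ℕ) : ℤ) • Φ P = 0 by rw [natCast_zsmul, ← map_nsmul, hP, map_zero])
  have key := hunip ⟨Q₀, hQ₀mem⟩
  have key' : τ • (τ • Q₀ - Q₀) = τ • Q₀ - Q₀ := by
    have := congrArg (fun Q : geomTorsion X ((p ^ n : ℕ) : ℤ) ↦ ((Q : geomPoints X))) key
    simpa only [AddSubgroupClass.coe_sub, Literature.NumberTheory.EllipticCurves.AddSubgroup.torsionBy.coe_smul]
      using this
  apply Φ.injective
  rw [hΦ, map_sub, hΦ]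
  exact key'

/-- **The global form: a unipotent element of `Γ_K` non-trivial on `E[p]`.**  Let `E/K` be an
elliptic curve over a number field, `v` a finite place of multiplicative reduction, `p` a prime
with `v ∤ p`, `n ≥ 1`, and suppose some element `τ` of the inertia group `I_𝔐 ≤ Γ_{K_v}` moves
some `p`-torsion point of `E(K̄_v)` (which holds when `p ∤ v(Δ_min)`:
`IsDedekindDomain.HeightOneSpectrum.exists_inertia_map_ne_of_multiplicative`,
`MultiplicativeRamifiedTorsionProofs`).  Then `σ = τ|_{K̄} ∈ Γ_K` (`resGal`) acts on
`E[p^n] = E(K̄)[p^n]` with `(σ - 1)² = 0` — `σ (σ P - P) = σ P - P` — and moves some `Q ∈ E[p^n]`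
with `p Q = O`: transport of `smul_smul_sub_eq_of_mem_inertia_of_hasMultiplicativeReductionAt`
along the equivariant injection `E(K̄) ↪ E(K̄_v)` (`pointsMap_smul`), every torsion point of
`E(K̄_v)` coming from `E(K̄)` (`exists_pointsMapOfEmb_eq_of_nsmul_eq_zero`).  This is the
hypothesis of `Literature.NumberTheory.EllipticCurves.hasSurjectiveModNGaloisRep_pow_of_unipotent`.
[cite: SilvermanATAEC1994, V.4–V.5 (Tate curve) and Exercise 5.13(b) (PDF p. 416)] [cite: SerreAbelianLadic1968, Ch. IV, A.1.2] -/
theorem exists_unipotent_of_hasMultiplicativeReductionAt [W.IsElliptic]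
    (hmult : W.HasMultiplicativeReductionAt v) {p : ℕ} (hp : p.Prime) (hpv : (p : 𝓞 K) ∉ v.asIdeal)
    {n : ℕ} (hn : 1 ≤ n)
    {w : Valuation (AlgebraicClosure (v.adicCompletion K)) ℝ≥0}
    (hw : ∀ x, (w x : ℝ) =
      spectralNorm (v.adicCompletion K) (AlgebraicClosure (v.adicCompletion K)) x)
    {𝔐 : Ideal v.localAbsIntegers} (h𝔐 : 𝔐 ∈ v.localPrimesAbove)
    (hram : ∃ τ ∈ 𝔐.inertia (absoluteGaloisGroup (v.adicCompletion K)),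
      ∃ Q : localPoints W (v.adicCompletion K), p • Q = 0 ∧ τ • Q ≠ Q) :
    ∃ σ : absoluteGaloisGroup K,
      (∀ P : geomTorsion W ((p ^ n : ℕ) : ℤ), σ • (σ • P - P) = σ • P - P) ∧
        ∃ Q : geomTorsion W ((p ^ n : ℕ) : ℤ), p • Q = 0 ∧ σ • Q ≠ Q := by
  obtain ⟨τ, hτ, Q, hpQ, hτQ⟩ := hram
  have hinj : Function.Injective (pointsMap W (v.adicCompletion K)) :=
    pointsMapOfEmb_injective W _
  refine ⟨resGal (K := K) (v.adicCompletion K) τ, fun P ↦ ?_, ?_⟩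
  · -- `(σ - 1)² = 0` on `E[p^n]`, read in `E(K̄_v)`
    have hP' : p ^ n • pointsMap W (v.adicCompletion K) (P : geomPoints W) = 0 := by
      rw [← map_nsmul, ← natCast_zsmul]
      have h2 : ((p ^ n : ℕ) : ℤ) • (P : geomPoints W) = 0 :=
        (Submodule.mem_torsionBy_iff _ _).mp P.2
      rw [h2, map_zero]
    have key := W.smul_smul_sub_eq_of_mem_inertia_of_hasMultiplicativeReductionAt hmult hp hpv hn
      hw h𝔐 hτ (pointsMap W (v.adicCompletion K) (P : geomPoints W)) hP'
    apply Subtype.ext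
    simp only [AddSubgroupClass.coe_sub,
      Literature.NumberTheory.EllipticCurves.AddSubgroup.torsionBy.coe_smul]
    apply hinj
    simp only [map_sub, pointsMap_smul]
    exact key
  · -- the moved `p`-torsion point comes from `E(K̄)`
    obtain ⟨P₀, hpP₀, hP₀Q⟩ := exists_pointsMapOfEmb_eq_of_nsmul_eq_zero W
      (closureEmb (K := K) (v.adicCompletion K)) hp.ne_zero hpQ
    have hmem : P₀ ∈ geomTorsion W ((p ^ n : ℕ) : ℤ) := by
      refine (Submodule.mem_torsionBy_iff _ _).mpr ?_
      change ((p ^ n : ℕ) : ℤ) • P₀ = 0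
      obtain ⟨k, rfl⟩ : ∃ k, n = k + 1 := ⟨n - 1, by omega⟩
      rw [natCast_zsmul, pow_succ, mul_nsmul, smul_comm, hpP₀, smul_zero]
    refine ⟨⟨P₀, hmem⟩, Subtype.ext ?_, fun h ↦ hτQ ?_⟩
    · simpa only [AddSubmonoidClass.coe_nsmul, ZeroMemClass.coe_zero] using hpP₀
    · have h' := congrArg
        (fun R : geomTorsion W ((p ^ n : ℕ) : ℤ) ↦ pointsMap W (v.adicCompletion K) (R : geomPoints W)) h
      simp only [Literature.NumberTheory.EllipticCurves.AddSubgroup.torsionBy.coe_smul,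
        pointsMap_smul] at h'
      rw [← hP₀Q]
      exact h'

end WeierstrassCurve

end
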